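import Summits.BirchSwinnertonDyer.BirchSwinnertonDyer.Theorems.GenusKolyvaginAtTwoGenusPrimitiveSupplyAtTwoTwistLocalConditionKummer
import Summits.BirchSwinnertonDyer.BirchSwinnertonDyer.Theorems.GenusKolyvaginAtTwoEquivariantKolyvaginExactAtTwoArchimedeanVanishingNegDisc
import Literature.NumberTheory.EllipticCurves.LocalKummerMap
import HarnessLib

/-!
# Route `GenusKolyvaginAtTwo`, crux #2 `GenusPrimitiveSupplyAtTwo` (stmt-BirchSwinnertonDyer-22136):
# the two TRIVIAL rows of Mazur–Rubin's Lemma 2.10 in X11b's Selmer-structure currency — (iv) the real place on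
# `Δ < 0` (`𝓛_∞ = ⊤`) and (ii) a finite `v ∤ n` with no rational `n`-torsion (`𝓛_v = ⊥`)

Width seat `bsd-line-gk2-p5` g8 (cell `bsd-f1-sign2`, SUPPLY lineage), third file of the series
(`…TwistLocalCondition` p618532, `…TwistLocalConditionKummer` p619414). THEOREMS ONLY (no definition, no named fact,
no `sorry`); helper `--supports stmt-BirchSwinnertonDyer-22136`; no item is closed; BSD is not proved by any of this.

WHY (crux workfile `Lines/genus-supply-mr-instantiation.md`). The per-place agreement hypothesis
`𝓐 v = 𝓚_E v` (`𝓐 v = (𝓚_Y v).map H¹(φ_v)`) of X11b's congruent-curve transfer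
(`CongruentTransfer.selmerGroup_sandwich_of_agree`) for the pair `(E, Y = E^{(d)})` at `p = 2` is now in the tree at the
places SPLIT in `K(√d)` (Lemma 2.10 (i), p619414) and at the good places UNRAMIFIED in `K(√d)` (Lemma 2.10 (v), X11b
`transport_kummer_inr_eq_of_good`). This file adds the two rows of the table that hold for a trivial reason — the ambient
local condition is ALL or NOTHING for both curves:

* `kummerLocalConditionAt_eq_top_of_forall_eq_zero`, `map_kummerLocalConditionAt_eq_of_eq_top` — if `H¹(E, X(K̄_E)) = 0`
  then `𝓛_{X,E} = ⊤`, and two curves with `𝓛 = ⊤` AGREE at `E` along ANY pair of inverse intertwining maps;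
* `kummerLocalConditionAt_infinitePlace_eq_top_of_Δ_neg`, `map_kummerLocalConditionAt_infinitePlace_eq_of_Δ_neg` —
  **Lemma 2.10 (iv) at `p = 2` over `ℚ`**: for `Δ(X) < 0`, `Δ(Y) < 0` (e.g. `Y = E^{(d)}`, `Δ(Y) = u⁻¹²d⁶Δ(E)`) the local
  `n`-Kummer conditions at the real place are `⊤` (gk2-p3 g10: `H¹(ℚ_∞, E) = 0`, `ArchVanishing.localH1_infinitePlace_eq_zero_of_Δ_neg`)
  and agree — X11b's `apply_inl_eq_of_odd` covers odd `n` only;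
* `kummerLocalConditionAt_adicCompletion_eq_bot_of_natCard_ker_eq_one`, `map_kummerLocalConditionAt_adicCompletion_eq_of_natCard_ker_eq_one`
  — **Lemma 2.10 (ii)**: at a finite `v ∤ n` where `X(K_v)[n] = 0` the local Kummer condition is `⊥` (Mazur–Rubin Lemma 2.2 (i)(ii) =
  the tree's `natCard_kummerLocalConditionAt_adicCompletion`: `#𝓛_v = #X(K_v)[n]·#(𝓞_v/n) = 1·1`), so two such curves agree — the
  SILENT ramified primes of the cell's DEF = 1 Heegner fields and descent-admissible `d`.

References: [MazurRubin2010] Lemma 2.2, Lemma 2.10 (ii), (iv); [MilneADT2006] I Lemma 3.3, Rem. 3.7; [GrossLMS1991] §6.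
-/

set_option linter.dupNamespace false -- tree convention: `Summit.BirchSwinnertonDyer.BirchSwinnertonDyer.Theorems` (summit = sub-problem)
set_option autoImplicit false

noncomputable section

open scoped Classical ContRepresentation

namespace Summit.BirchSwinnertonDyer.BirchSwinnertonDyer.Theorems.GenusKolyTwistLocal

open WeierstrassCurve Field NumberField IsDedekindDomain
open Literature.NumberTheory.EllipticCurves Literature.NumberTheory.GaloisRepresentations

universe u

/-! ## §8 All-or-nothing local conditions agree along any pair of inverse intertwining maps -/

section Generic

variable {K : Type u} [Field K] (X Y : WeierstrassCurve K) (n : ℤ) (E : Type u) [Field E] [Algebra K E]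

/-- If `H¹(E, X(K̄_E)) = 0` then the local Kummer condition of `X[n]` at `E` is everything. [cite: MilneADT2006, I Rem. 3.7] -/
theorem kummerLocalConditionAt_eq_top_of_forall_eq_zero
    (h : ∀ x : galoisCohomology (X.localGaloisModule E) 1, x = 0) :
    X.kummerLocalConditionAt n E = ⊤ := by
  rw [eq_top_iff]
  intro c _
  rw [mem_kummerLocalConditionAt_iff]
  exact h _

/-- `H¹(g) (H¹(f) x) = x` on `H¹(Γ_E, ·)` when `g ∘ f = id` (X11b `Levels.map_map_eq_self_of_comp_eq`, restated for the
restricted modules to keep this file's imports light). [folklore] -/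
theorem map_restrictField_map_restrictField_eq_self
    (f : (X.torsionGaloisModule n).toContRepresentation →ⁱL (Y.torsionGaloisModule n).toContRepresentation)
    (g : (Y.torsionGaloisModule n).toContRepresentation →ⁱL (X.torsionGaloisModule n).toContRepresentation)
    (hgf : ∀ a, g (f a) = a)
    (x : galoisCohomology (GaloisRep.restrictField E (X.torsionGaloisModule n)) 1) :
    galoisCohomology.map (g.restrictField E) 1 (galoisCohomology.map (f.restrictField E) 1 x) = x := by
  obtain ⟨φ, rfl⟩ := oneCocycleClass_surjective _ x
  rw [galoisCohomology.map_one_oneCocycleClass, galoisCohomology.map_one_oneCocycleClass]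
  exact congrArg (oneCocycleClass _) (Subtype.ext (ContinuousMap.ext fun σ ↦ hgf (φ.1 σ)))

/-- **Two curves whose local Kummer conditions at `E` are both `⊤` AGREE there along any pair of inverse intertwining
maps** (`H¹(φ∣_E)` is onto). [folklore] -/
theorem map_kummerLocalConditionAt_eq_of_eq_top
    (φ : (Y.torsionGaloisModule n).toContRepresentation →ⁱL (X.torsionGaloisModule n).toContRepresentation)
    (φ' : (X.torsionGaloisModule n).toContRepresentation →ⁱL (Y.torsionGaloisModule n).toContRepresentation)
    (hφφ' : ∀ b, φ (φ' b) = b) (hY : Y.kummerLocalConditionAt n E = ⊤) (hX : X.kummerLocalConditionAt n E = ⊤) :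
    (Y.kummerLocalConditionAt n E).map (galoisCohomology.map (φ.restrictField E) 1) =
      X.kummerLocalConditionAt n E := by
  rw [hY, hX, eq_top_iff]
  intro x _
  rw [AddSubgroup.mem_map]
  exact ⟨galoisCohomology.map (φ'.restrictField E) 1 x, AddSubgroup.mem_top _,
    map_restrictField_map_restrictField_eq_self X Y n E φ' φ hφφ' x⟩

/-- **Two curves whose local Kummer conditions at `E` are both `⊥` AGREE there along any intertwining map.**
[folklore] -/
theorem map_kummerLocalConditionAt_eq_of_eq_bot
    (φ : (Y.torsionGaloisModule n).toContRepresentation →ⁱL (X.torsionGaloisModule n).toContRepresentation)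
    (hY : Y.kummerLocalConditionAt n E = ⊥) (hX : X.kummerLocalConditionAt n E = ⊥) :
    (Y.kummerLocalConditionAt n E).map (galoisCohomology.map (φ.restrictField E) 1) =
      X.kummerLocalConditionAt n E := by
  rw [hY, hX, AddSubgroup.map_bot]

end Generic

/-! ## §9 Lemma 2.10 (iv) at `p = 2`: the real place on `Δ < 0` -/

section RealPlace

variable (X Y : WeierstrassCurve ℚ) [X.IsElliptic] [Y.IsElliptic] (n : ℤ) (w : InfinitePlace ℚ)

/-- **`Δ(X) < 0` ⟹ the local `n`-Kummer condition at the real place is EVERYTHING** (`H¹(ℚ_∞, X) = 0`, gk2-p3's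
`localH1_infinitePlace_eq_zero_of_Δ_neg`; any `n`). In X11b's place currency this is the value at `Sum.inl w` of the Kummer
Selmer structure (`kummerSelmerStructure_apply`). [cite: MilneADT2006, I Rem. 3.7] [cite: GrossLMS1991, §6 (proof of Prop. 6.2 (1))] -/
theorem kummerLocalConditionAt_infinitePlace_eq_top_of_Δ_neg (hΔ : X.Δ < 0) :
    X.kummerLocalConditionAt n w.Completion = ⊤ :=
  kummerLocalConditionAt_eq_top_of_forall_eq_zero X n w.Completion fun x ↦
    GenusExact.ArchVanishing.localH1_infinitePlace_eq_zero_of_Δ_neg X w hΔ x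

/-- **Mazur–Rubin Lemma 2.10 (iv) at `p = 2` over `ℚ`, in X11b's currency**: two elliptic curves over `ℚ` with NEGATIVE
discriminants — e.g. `E` and any model of a quadratic twist `E^{(d)}` (`Δ(E^{(d)}) = u⁻¹²d⁶Δ(E)`) — have AGREEING local
`n`-Kummer conditions at the real place along any pair of inverse intertwining maps `Y[n] ⇄ X[n]`: both are `⊤`. (X11b's
`CongruentTransfer.apply_inl_eq_of_odd` is the odd-`n` version, where `H¹(ℝ, M) = 0` for the coefficients instead.)
[cite: MazurRubin2010, Lemma 2.10 (iv)] [cite: MilneADT2006, I Rem. 3.7] -/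
theorem map_kummerLocalConditionAt_infinitePlace_eq_of_Δ_neg (hX : X.Δ < 0) (hY : Y.Δ < 0)
    (φ : (Y.torsionGaloisModule n).toContRepresentation →ⁱL (X.torsionGaloisModule n).toContRepresentation)
    (φ' : (X.torsionGaloisModule n).toContRepresentation →ⁱL (Y.torsionGaloisModule n).toContRepresentation)
    (hφφ' : ∀ b, φ (φ' b) = b) :
    (Y.kummerLocalConditionAt n w.Completion).map (galoisCohomology.map (φ.restrictField w.Completion) 1) =
      X.kummerLocalConditionAt n w.Completion :=
  map_kummerLocalConditionAt_eq_of_eq_top X Y n w.Completion φ φ' hφφ'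
    (kummerLocalConditionAt_infinitePlace_eq_top_of_Δ_neg Y n w hY)
    (kummerLocalConditionAt_infinitePlace_eq_top_of_Δ_neg X n w hX)

end RealPlace

/-! ## §10 Lemma 2.10 (ii): a finite place `v ∤ n` with no rational `n`-torsion -/

section SilentPlace

variable {K : Type} [Field K] [NumberField K] (X Y : WeierstrassCurve K) [X.IsElliptic] [Y.IsElliptic]
  (v : HeightOneSpectrum (𝓞 K)) {n : ℕ}

/-- `#(𝓞_v / n𝓞_v) = 1` when `v ∤ n`. [folklore] -/
theorem natCard_quotient_span_natCast_eq_one_of_not_mem (hnv : (n : 𝓞 K) ∉ v.asIdeal) :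
    Nat.card (v.adicCompletionIntegers K ⧸ Ideal.span {(n : v.adicCompletionIntegers K)}) = 1 := by
  have hu : IsUnit (n : v.adicCompletionIntegers K) := by
    have h := HeightOneSpectrum.isUnit_algebraMap_adicCompletionIntegers K v hnv
    rwa [map_natCast] at h
  rw [Ideal.span_singleton_eq_top.mpr hu]
  haveI : Subsingleton (v.adicCompletionIntegers K ⧸ (⊤ : Ideal (v.adicCompletionIntegers K))) :=
    Ideal.Quotient.subsingleton_iff.mpr rfl
  exact Nat.card_of_subsingleton (0 : v.adicCompletionIntegers K ⧸ (⊤ : Ideal _))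

/-- **Lemma 2.10 (ii) / Lemma 2.2: at a finite `v ∤ n` with `X(K_v)[n] = 0` the local `n`-Kummer condition is `⊥`.**
By the tree's `natCard_kummerLocalConditionAt_adicCompletion` (Milne I Lemma 3.3): `#𝓛_v = #X(K_v)[n] · #(𝓞_v/n) = 1 · 1`.
[cite: MazurRubin2010, Lemma 2.2 (i)(ii) and Lemma 2.10 (ii)] [cite: MilneADT2006, I Lemma 3.3] -/
theorem kummerLocalConditionAt_adicCompletion_eq_bot_of_natCard_ker_eq_one (hn : n ≠ 0)
    (hnv : (n : 𝓞 K) ∉ v.asIdeal)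
    (h1 : Nat.card (nsmulAddMonoidHom n : (X.baseChange (v.adicCompletion K)).toAffine.Point →+ _).ker = 1) :
    X.kummerLocalConditionAt (n : ℤ) (v.adicCompletion K) = ⊥ := by
  rw [← AddSubgroup.card_eq_one, X.natCard_kummerLocalConditionAt_adicCompletion v hn, h1,
    natCard_quotient_span_natCast_eq_one_of_not_mem v hnv, mul_one]

/-- **Mazur–Rubin Lemma 2.10 (ii) in X11b's currency**: two elliptic curves `X, Y` over a number field `K` with NO
`K_v`-rational `n`-torsion at a finite `v ∤ n` — e.g. `E` and a model of `E^{(d)}` at a SILENT prime `v ∣ d`, `v ∤ 2`,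
`E(K_v)[2] = 0 = E^{(d)}(K_v)[2]` (the `2`-division cubics have the same roots up to `x ↦ u²dx + r`) — have AGREEING (trivial)
local `n`-Kummer conditions at `v` along any intertwining map `Y[n] ⟶ X[n]`.
[cite: MazurRubin2010, Lemma 2.10 (ii)] [cite: MilneADT2006, I Lemma 3.3] -/
theorem map_kummerLocalConditionAt_adicCompletion_eq_of_natCard_ker_eq_one (hn : n ≠ 0)
    (hnv : (n : 𝓞 K) ∉ v.asIdeal)
    (hX : Nat.card (nsmulAddMonoidHom n : (X.baseChange (v.adicCompletion K)).toAffine.Point →+ _).ker = 1)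
    (hY : Nat.card (nsmulAddMonoidHom n : (Y.baseChange (v.adicCompletion K)).toAffine.Point →+ _).ker = 1)
    (φ : (Y.torsionGaloisModule (n : ℤ)).toContRepresentation →ⁱL
      (X.torsionGaloisModule (n : ℤ)).toContRepresentation) :
    (Y.kummerLocalConditionAt (n : ℤ) (v.adicCompletion K)).map
        (galoisCohomology.map (φ.restrictField (v.adicCompletion K)) 1) =
      X.kummerLocalConditionAt (n : ℤ) (v.adicCompletion K) :=
  map_kummerLocalConditionAt_eq_of_eq_bot X Y (n : ℤ) (v.adicCompletion K) φ
    (kummerLocalConditionAt_adicCompletion_eq_bot_of_natCard_ker_eq_one Y v hn hnv hY)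
    (kummerLocalConditionAt_adicCompletion_eq_bot_of_natCard_ker_eq_one X v hn hnv hX)

end SilentPlace

end Summit.BirchSwinnertonDyer.BirchSwinnertonDyer.Theorems.GenusKolyTwistLocal

end
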